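import Literature.MathematicalPhysics.QuantumFieldTheory.Balaban1983to89.T4AdjointCovarianceUnitary
import Literature.MathematicalPhysics.QuantumFieldTheory.Balaban1983to89.LogChartClosedSubgroup

/-!
# `Balaban1983to89.T4AdjointCovarianceClosedSubgroup` — [Balaban1985Averaging] (56)–(57) «R(U)X = UXU⁻¹», «R(X)R(Y) = R(XY),
# R(X)⁻¹ = R(X⁻¹)», «R(X)f(Y) = f(R(X)Y)» FOR EVERY CLOSED SUBGROUP `G ≤ U(N)` ACTING ON ITS OWN LIE ALGEBRA 𝐠:
# the adjoint data `(Ad, expV, nV)` of `T4AdjointCovariance` INSTANTIATED at print's generality «G ⊂ U(N) a Lie subgroup»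

statement-level skeleton of published theorems with citation tags; proofs where landed; nothing here is a claim about the Yang–Mills mass gap

v1.1 (docstring-only erratum, CITELOC DELTA #7 row P40-001 of b2b-balaban-summit-lit1 g40, read on the page image): [Balaban1985Averaging]
(17) «⟨X, Y⟩ = tr X*Y, tr X = N⁻¹ Σ_j X_{jj}» is printed on **p. 20** (v1.0 had p. 21; (19) stays p. 21); the Frobenius inner product
`Re Tr(X*Y)` used below is `N ×` the printed one — immaterial for `norm_closedAd` and the (1.18)/(1.19) statements.  Declarations unchanged.

Unit `lit-balaban-p24` gen 10 (Phase-2 proof seat, free-target protocol G.5-34(d), own Lie lane; successor of gen 8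
`LogChartClosedSubgroup`).  HOME `run/shared/lean/pub/lit-balaban/`, seat dir `lit-balaban-p24/`.  SKELETON rows served
(support cells, NO head change): B7.Eq56-1.1 (adjoint action, owner r04 / carrier r18), B14.Eq1.17 and B14.Eq1.15-1.19
(owner r11 / r18), B7.Sect§A / B12.Def§0 («G ⊂ U(N) a Lie subgroup … 𝐠», owners r04, r09/r20).

CITATION HEADER.  T. Bałaban, *Averaging operations for lattice gauge theories*, Commun. Math. Phys. **98** (1985) 17–51
[Balaban1985Averaging] (= B7): p. 18 «a Lie subgroup G of a unitary group U(N)», p. 20 «the group G is obtained by applying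
the function e^{iA} to A ∈ 𝔤», p. 20 (17) (the L²/Hilbert–Schmidt scalar product, normalised trace) and p. 21 (19) «It is the operator norm», p. 27
(56)–(57) «where for arbitrary invertible matrix X the operator R(X) is given by the formula R(X)Y = XYX^{−1}.» «R(X) acts
on the algebra of all matrices and has the following properties: R(X)f(Y) = f(R(X)Y) for analytic functions f,
R(X)R(Y) = R(XY), R(X)^{−1} = R(X^{−1}), R(X)* = R(X*).»; T. Bałaban, Commun. Math. Phys. **109** (1987) 249–301
[Balaban1987RG1] (= B12) pp. 251–252 «G is … a Lie subgroup of a group of complex unitary matrices, for example G ⊂ U(N)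
… A Lie algebra of the group G is denoted by 𝐠»; Commun. Math. Phys. **99** (1985) 389–434
[Balaban1985BackgroundPropagators] (= B9) p. 395 «Of course R(u(x))exp iηA(x,x′) = exp iηR(u(x))A(x,x′) and R(u)A is
linear in A»; Commun. Math. Phys. **119** (1988) 243–285 [Balaban1988Convergent] (= B14) p. 250 (1.17)–(1.19).  All
quotations are re-used VERBATIM from loci already render-certified in the cell (`T4AdjointCovariance`,
`T4AdjointCovarianceUnitary`, `LogChartClosedSubgroup`); no new printed locus is read by this module.  Lie theory:
[Hall2015] Def. 3.18 / Thm. 3.20 (1) «AXA⁻¹ ∈ 𝔤 for all A ∈ G» — in the tree as `LogChart.conj_mem_lie` (gen 8) /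
`QuantumLattice.conj_mem_matrixLieAlgebra`.

WHY THIS FILE (honest scope).  `T4AdjointCovariance` (pub-balaban, node O3.E-i′ (α)) types the adjoint representation
«R(u)» ABSTRACTLY — `Ad : G → (V ≃ₗᵢ[ℝ] V)`, `expV : V → G`, `nV : V → ℝ` — with the printed properties as the
hypotheses `hmul`, `hinv`, `hexp`, `hn`; `T4AdjointCovarianceUnitary` discharged them for `G = U(n)` on `𝔲(n)` and
`G = SU(n)` on `𝔰𝔲(n)` and records «NOT CLAIMED / NOT DONE. (i) A general closed Lie subgroup `G ⊂ U(N)` (B7 p. 20) with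
its own Lie algebra is not treated — only `U(n)` and `SU(n)`».  THIS FILE TREATS IT: for EVERY closed subgroup
`G ≤ U(N)` (print's «Lie subgroup», read as closed = compact as in gen 8) acting by `X ↦ gXg*` on ITS OWN Lie algebra
`𝐠 = lieG G hG := (unitarySubgroupLogChart G hG).lie` ([Hall2015] Def. 3.18: `{X : e^{tX} ∈ G ∀ t}`, gen 8; the SAME
submodule as `QuantumLattice.matrixLieAlgebra ↑G`, `LogChartClosedSubgroup.unitarySubgroupLogChart_lie_eq_matrixLieAlgebra`)
with the Hilbert–Schmidt inner product of `M_N(ℂ)`: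
* §1 `lieG G hG ≤ lieU n` (𝐠 ⊆ 𝔲(N)), `conj_mem_lieG` («AXA⁻¹ ∈ 𝔤», Ad-STABILITY, by `LogChart.conj_mem_lie`), the pinned
  normed / inner-product / Borel instances on 𝐠, and **`closedAd G hG : ↥G → (lieG G hG ≃ₗᵢ[ℝ] lieG G hG)`**, `g ↦ (X ↦ gXg*)`,
  with `closedAd_mul` (hmul, «R(X)R(Y) = R(XY)»), `closedAd_inv_apply` (hinv, «R(X)⁻¹ = R(X⁻¹)»), `closedAd_one`;
* §2 **`closedExp G hG : lieG G hG → ↥G`**, `X ↦ e^X ∈ G` (the chart's `exp_mem`: «G is obtained by applying e^{iA} to A ∈ 𝔤»),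
  with `closedExp_closedAd` (hexp, «R(X)f(Y) = f(R(X)Y)» for f = exp / B9 p. 395);
* §3 `norm_closedAd` (hn for (17)), `opNormG_closedAd` (hn for the operator norm (19));
* §4 CONSEQUENCES with the cell's canonical `GaugeGroup.ofUnitaryRep` structure on `↥G` (gen 9 `B16ZLowerCompactGroup` §4):
  `opCovariant_covDeriv_closedSubgroup` (the covariant derivative (3.3) is a covariant family), `mixedSmallOn_joint_iff_closedSubgroup`
  ((1.19) jointly invariant), `invariant_charFn_supSmallOn_closedSubgroup(_opNorm)` ((1.18)), `pi_volume_map_closedAd`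
  (Lebesgue measure on 𝐠-valued fluctuation fields is Ad-invariant), `conjInvariant_marginal_closedSubgroup` (the hand-off).
NOT CLAIMED: as in the U(n) file, the reference-field fixedness `hW` of the mixed cut-off is NOT discharged (O-α4 (ii));
no operator of the papers is constructed; no estimate; nothing of B7/B9/B12/B14 beyond the quoted algebra is asserted.
Everything is kernel-proved from Mathlib, `T4AdjointCovariance(Unitary)` and `LogChartClosedSubgroup`; 0 `sorry`, 0 named
facts, axioms standard.  No SKELETON head changes.
-/

noncomputable section

open MeasureTheory
open Matrix

namespace Literature.MathematicalPhysics.QuantumFieldTheory.Balaban1983to89.T4AdjointCovarianceClosedSubgroup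

open T4AdjointCovariance T4NestedCovariance T4NestedCovarianceFibre GaugeField
open T4FlatExteriorInvariance hiding conjEquiv coe_conjEquiv
open T4AdjointCovarianceUnitary (lieU mem_lieU_iff conjL conjL_apply conj_mul_conj conj_conj_of_mul_eq_one
  star_coe_mul_coe coe_mul_star_coe inner_conj_unitary opNorm_conj_unitary exp_conj_unitary
  exp_mem_unitaryGroup_of_mem_lieU)
open LogChartClosedSubgroup (unitarySubgroupLogChart unitarySubgroupLogChart_carrier
  star_eq_neg_of_mem_unitarySubgroupLogChart_lie mem_unitarySubgroupLogChart_lie_iff)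

variable {n : Type*} [Fintype n] [DecidableEq n]
variable (G : Subgroup (Matrix.unitaryGroup n ℂ)) (hG : IsClosed (G : Set (Matrix.unitaryGroup n ℂ)))

/-! ## §1 The Lie algebra 𝐠 of a closed `G ≤ U(N)` and the adjoint action of `G` on it -/

section LieAlgebra

-- gen 8's log-charts on `M_N(ℂ)` are typed with the OPERATOR norm (19) (`UnitaryModel`); the statements below are norm-free.
open scoped Matrix.Norms.L2Operator

/-- **𝐠, THE LIE ALGEBRA OF THE CLOSED SUBGROUP `G ≤ U(N)`** (print: «A Lie algebra of the group G is denoted by 𝐠»):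
the `lie` of gen 8's log-chart `unitarySubgroupLogChart G hG`, i.e. `{X ∈ M_N(ℂ) : e^{tX} ∈ G ∀ t ∈ ℝ}` ([Hall2015]
Def. 3.18) — the same real submodule as `QuantumLattice.matrixLieAlgebra ↑G`
(`LogChartClosedSubgroup.unitarySubgroupLogChart_lie_eq_matrixLieAlgebra`). [cite: Balaban1987RG1, §0 p.252] -/
def lieG : Submodule ℝ (Matrix n n ℂ) := (unitarySubgroupLogChart G hG).lie

/-- Membership in 𝐠: `e^{tX} ∈ G` for all real `t`. [cite: Balaban1987RG1, §0 p.252] -/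
theorem mem_lieG_iff {X : Matrix n n ℂ} :
    X ∈ lieG G hG ↔ ∀ t : ℝ, NormedSpace.exp (t • X) ∈ (Subtype.val '' (G : Set (Matrix.unitaryGroup n ℂ)) : Set (Matrix n n ℂ)) :=
  mem_unitarySubgroupLogChart_lie_iff G hG

/-- **𝐠 ⊆ 𝔲(N)**: every `X ∈ 𝐠` is skew-Hermitian. [cite: Balaban1987RG1, §0 p.252] -/
theorem lieG_le_lieU : lieG G hG ≤ lieU n := fun _ hX =>
  mem_lieU_iff.2 (star_eq_neg_of_mem_unitarySubgroupLogChart_lie G hG hX)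

/-- `g ∈ G`, read in `M_N(ℂ)`, lies in the carrier of the chart. [cite: Balaban1987RG1, §0 pp.251–252] -/
theorem coe_mem_carrier (g : G) :
    ((g : Matrix.unitaryGroup n ℂ) : Matrix n n ℂ) ∈ (unitarySubgroupLogChart G hG).carrier :=
  ⟨(g : Matrix.unitaryGroup n ℂ), g.2, rfl⟩

/-- **Ad-STABILITY «AXA⁻¹ ∈ 𝔤 for all A ∈ G»** ([Hall2015] Thm. 3.20 (1), tree `LogChart.conj_mem_lie`): for `g ∈ G` and
`X ∈ 𝐠`, `gXg* ∈ 𝐠`. [cite: Balaban1985Averaging, (56)–(57) p.27] -/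
theorem conj_mem_lieG (g : G) {X : Matrix n n ℂ} (hX : X ∈ lieG G hG) :
    ((g : Matrix.unitaryGroup n ℂ) : Matrix n n ℂ) * X * star ((g : Matrix.unitaryGroup n ℂ) : Matrix n n ℂ) ∈ lieG G hG := by
  have hinv : star ((g : Matrix.unitaryGroup n ℂ) : Matrix n n ℂ) ∈ (unitarySubgroupLogChart G hG).carrier := by
    rw [← Matrix.UnitaryGroup.inv_val]
    exact coe_mem_carrier G hG g⁻¹
  exact (unitarySubgroupLogChart G hG).conj_mem_lie (coe_mem_carrier G hG g) hinv
    (star_coe_mul_coe (g : Matrix.unitaryGroup n ℂ)) hX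

/-- The adjoint action of `g ∈ G` on 𝐠 as a real-linear map. [cite: Balaban1985Averaging, (56) p.27] -/
def adLinG (g : G) : lieG G hG →ₗ[ℝ] lieG G hG :=
  (conjL ((g : Matrix.unitaryGroup n ℂ) : Matrix n n ℂ)).restrict fun _ hX => conj_mem_lieG G hG g hX

/-- `adLinG g X = g X g*` on underlying matrices. [cite: Balaban1985Averaging, (56) p.27] -/
@[simp] theorem coe_adLinG (g : G) (X : lieG G hG) :
    ((adLinG G hG g X : lieG G hG) : Matrix n n ℂ) =
      ((g : Matrix.unitaryGroup n ℂ) : Matrix n n ℂ) * X * star ((g : Matrix.unitaryGroup n ℂ) : Matrix n n ℂ) := rfl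

/-- The adjoint action of `g ∈ G` on 𝐠 as a real-linear AUTOMORPHISM (inverse: the action of `g⁻¹ = g*`).
[cite: Balaban1985Averaging, (57) p.27] -/
def adEquivG (g : G) : lieG G hG ≃ₗ[ℝ] lieG G hG :=
  { adLinG G hG g with
    invFun := adLinG G hG g⁻¹
    left_inv := fun X => Subtype.ext <| by
      change ((g⁻¹ : G) : Matrix.unitaryGroup n ℂ).1 * (((g : Matrix.unitaryGroup n ℂ) : Matrix n n ℂ) * X *
        star ((g : Matrix.unitaryGroup n ℂ) : Matrix n n ℂ)) * star ((g⁻¹ : G) : Matrix.unitaryGroup n ℂ).1 = X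
      rw [Subgroup.coe_inv, Matrix.UnitaryGroup.inv_val]
      exact conj_conj_of_mul_eq_one (star_coe_mul_coe (g : Matrix.unitaryGroup n ℂ)) (X : Matrix n n ℂ)
    right_inv := fun X => Subtype.ext <| by
      change ((g : Matrix.unitaryGroup n ℂ) : Matrix n n ℂ) * (((g⁻¹ : G) : Matrix.unitaryGroup n ℂ).1 * X *
        star ((g⁻¹ : G) : Matrix.unitaryGroup n ℂ).1) * star ((g : Matrix.unitaryGroup n ℂ) : Matrix n n ℂ) = X
      rw [Subgroup.coe_inv, Matrix.UnitaryGroup.inv_val]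
      exact conj_conj_of_mul_eq_one (coe_mul_star_coe (g : Matrix.unitaryGroup n ℂ)) (X : Matrix n n ℂ) }

/-- `adEquivG g X = g X g*` on underlying matrices. [cite: Balaban1985Averaging, (56) p.27] -/
@[simp] theorem coe_adEquivG (g : G) (X : lieG G hG) :
    ((adEquivG G hG g X : lieG G hG) : Matrix n n ℂ) =
      ((g : Matrix.unitaryGroup n ℂ) : Matrix n n ℂ) * X * star ((g : Matrix.unitaryGroup n ℂ) : Matrix n n ℂ) := rfl

/-- `e^X ∈ G` for `X ∈ 𝐠` — «the group G is obtained by applying the function e^{iA} to A ∈ 𝔤» (p. 20), here the chart's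
`exp_mem` for the closed subgroup `G`. [cite: Balaban1985Averaging, §A p.20] -/
theorem exp_mem_of_mem_lieG {X : Matrix n n ℂ} (hX : X ∈ lieG G hG) :
    (⟨NormedSpace.exp X, exp_mem_unitaryGroup_of_mem_lieU (lieG_le_lieU G hG hX)⟩ : Matrix.unitaryGroup n ℂ) ∈ G := by
  obtain ⟨u, hu, hux⟩ := (unitarySubgroupLogChart G hG).exp_mem hX
  have : u = ⟨NormedSpace.exp X, exp_mem_unitaryGroup_of_mem_lieU (lieG_le_lieU G hG hX)⟩ := Subtype.ext hux
  exact this ▸ hu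

end LieAlgebra

/-! ### The operator norm (19) on 𝐠 -/

section OpNorm

open scoped Matrix.Norms.L2Operator

/-- THE OPERATOR NORM (19) restricted to 𝐠. [cite: Balaban1985Averaging, (19) p.21] -/
def opNormG (X : lieG G hG) : ℝ := ‖(X : Matrix n n ℂ)‖

end OpNorm

/-! ### The Hilbert–Schmidt model on 𝐠: pinned instances, the isometric adjoint representation -/

section Frobenius

open scoped Matrix.Norms.Frobenius

attribute [local instance] Literature.MathematicalPhysics.QuantumLattice.frobeniusInnerProductSpace

/-- 𝐠 with THE HILBERT–SCHMIDT NORM (17) induced from `M_N(ℂ)`. [cite: Balaban1985Averaging, (17) p.20] -/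
instance instNormedAddCommGroupLieG : NormedAddCommGroup (lieG G hG) := Submodule.normedAddCommGroup _

/-- (the seminormed structure underlying `instNormedAddCommGroupLieG`). [folklore] -/
instance instSeminormedAddCommGroupLieG : SeminormedAddCommGroup (lieG G hG) :=
  NormedAddCommGroup.toSeminormedAddCommGroup

/-- 𝐠 as a real inner-product space, `⟪X, Y⟫ = Re Tr(X*Y)` (print's (17) uses the normalised trace `tr = N⁻¹ Tr`; the
scalar `N⁻¹` is immaterial for every statement below). [cite: Balaban1985Averaging, (17) p.20] -/
instance instInnerProductSpaceLieG : InnerProductSpace ℝ (lieG G hG) := Submodule.innerProductSpace _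

/-- The Borel σ-algebra on 𝐠 generated by its norm topology (pinned path, as for `𝔲(n)` in `T4AdjointCovarianceUnitary`).
[folklore] -/
instance instMeasurableSpaceLieG : MeasurableSpace (lieG G hG) :=
  @borel (lieG G hG) (@UniformSpace.toTopologicalSpace _ (@PseudoMetricSpace.toUniformSpace _
    (@SeminormedAddCommGroup.toPseudoMetricSpace _ (instSeminormedAddCommGroupLieG G hG))))

/-- `instMeasurableSpaceLieG` is the Borel σ-algebra of the norm topology of 𝐠. [folklore] -/
instance instBorelSpaceLieG : @BorelSpace (lieG G hG) (@UniformSpace.toTopologicalSpace _ (@PseudoMetricSpace.toUniformSpace _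
    (@SeminormedAddCommGroup.toPseudoMetricSpace _ (instSeminormedAddCommGroupLieG G hG)))) (instMeasurableSpaceLieG G hG) :=
  ⟨rfl⟩

/-- … which is also the Borel σ-algebra of the subspace topology inherited from `M_N(ℂ)`. [folklore] -/
instance instBorelSpaceLieG' : @BorelSpace (lieG G hG) instTopologicalSpaceSubtype (instMeasurableSpaceLieG G hG) := ⟨rfl⟩

/-- `(X : 𝐠)` has the Hilbert–Schmidt (Frobenius) norm (17) of its matrix. [cite: Balaban1985Averaging, (17) p.20] -/
theorem norm_coe_lieG (X : lieG G hG) : ‖X‖ = ‖(X : Matrix n n ℂ)‖ := rfl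

/-- **THE ADJOINT REPRESENTATION «R(U)X = UXU⁻¹» OF THE CLOSED SUBGROUP `G ≤ U(N)` ON ITS LIE ALGEBRA 𝐠** as a family of
LINEAR ISOMETRIES for the Hilbert–Schmidt inner product — the instance of the abstract `Ad : G → (V ≃ₗᵢ[ℝ] V)` of
`T4AdjointCovariance` for every «Lie subgroup G of a unitary group U(N)» (p. 18).
[cite: Balaban1985Averaging, (56) p.27; Balaban1988Convergent, (1.17) p.250] -/
def closedAd (g : G) : lieG G hG ≃ₗᵢ[ℝ] lieG G hG :=
  (adEquivG G hG g).isometryOfInner fun X Y => by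
    rw [Submodule.coe_inner, Submodule.coe_inner, coe_adEquivG, coe_adEquivG]
    exact inner_conj_unitary (g : Matrix.unitaryGroup n ℂ) X Y

/-- `closedAd g X = g X g*` on underlying matrices. [cite: Balaban1985Averaging, (56) p.27] -/
@[simp] theorem coe_closedAd (g : G) (X : lieG G hG) :
    ((closedAd G hG g X : lieG G hG) : Matrix n n ℂ) =
      ((g : Matrix.unitaryGroup n ℂ) : Matrix n n ℂ) * X * star ((g : Matrix.unitaryGroup n ℂ) : Matrix n n ℂ) := rfl

/-- **HYPOTHESIS `hmul` OF `T4AdjointCovariance` DISCHARGED for every closed `G ≤ U(N)`: «R(X)R(Y) = R(XY)».**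
[cite: Balaban1985Averaging, (57) p.27] -/
theorem closedAd_mul (g h : G) (X : lieG G hG) : closedAd G hG (g * h) X = closedAd G hG g (closedAd G hG h X) := by
  apply Subtype.ext
  simp only [coe_closedAd, Subgroup.coe_mul, Matrix.UnitaryGroup.mul_val]
  exact conj_mul_conj _ _ _

/-- **HYPOTHESIS `hinv` OF `T4AdjointCovariance` DISCHARGED for every closed `G ≤ U(N)`: «R(X)^{−1} = R(X^{−1})».**
[cite: Balaban1985Averaging, (57) p.27] -/
theorem closedAd_inv_apply (g : G) (X : lieG G hG) : closedAd G hG g⁻¹ (closedAd G hG g X) = X :=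
  (adEquivG G hG g).left_inv X

/-- `Ad(1) = id`. [cite: Balaban1985Averaging, (57) p.27] -/
theorem closedAd_one (X : lieG G hG) : closedAd G hG (1 : G) X = X := by
  apply Subtype.ext
  simp only [coe_closedAd, Subgroup.coe_one, Matrix.UnitaryGroup.one_val, star_one, Matrix.one_mul, Matrix.mul_one]

/-! ## §2 The exponential map `𝐠 → G` -/

/-- **THE EXPONENTIAL MAP `𝐠 → G`, `X ↦ e^X`** — the instance of the abstract `expV : V → G` of
`T4AdjointCovariance.MixedSmallOn` for every closed `G ≤ U(N)` (constants absorbed, `X = iA`).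
[cite: Balaban1985Averaging, §A p.20; Balaban1988Convergent, (1.19) p.250] -/
def closedExp (X : lieG G hG) : G :=
  ⟨⟨NormedSpace.exp (X : Matrix n n ℂ), exp_mem_unitaryGroup_of_mem_lieU (lieG_le_lieU G hG X.2)⟩, exp_mem_of_mem_lieG G hG X.2⟩

/-- `closedExp X = e^X` on underlying matrices. [cite: Balaban1985Averaging, §A p.20] -/
@[simp] theorem coe_closedExp (X : lieG G hG) :
    (((closedExp G hG X : G) : Matrix.unitaryGroup n ℂ) : Matrix n n ℂ) = NormedSpace.exp (X : Matrix n n ℂ) := rfl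

/-- **HYPOTHESIS `hexp` OF `T4AdjointCovariance` DISCHARGED for every closed `G ≤ U(N)`: «R(X)f(Y) = f(R(X)Y)» for
`f = exp`, i.e. «Of course R(u(x))exp iηA(x,x′) = exp iηR(u(x))A(x,x′)» — `closedExp (Ad(g)X) = g · closedExp X · g⁻¹` in `G`.**
[cite: Balaban1985Averaging, (57) p.27; Balaban1985BackgroundPropagators, (3.29) p.395] -/
theorem closedExp_closedAd (g : G) (X : lieG G hG) :
    closedExp G hG (closedAd G hG g X) = g * closedExp G hG X * g⁻¹ := by
  apply Subtype.ext
  apply Subtype.ext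
  simp only [Subgroup.coe_mul, Subgroup.coe_inv, Matrix.UnitaryGroup.mul_val, Matrix.UnitaryGroup.inv_val]
  exact exp_conj_unitary (g : Matrix.unitaryGroup n ℂ) X

/-! ## §3 Norm invariance -/

/-- **HYPOTHESIS `hn` DISCHARGED for the Hilbert–Schmidt norm (17)**: `|gXg*| = |X|` on 𝐠. [cite: Balaban1985Averaging, (17) p.20] -/
theorem norm_closedAd (g : G) (X : lieG G hG) : ‖closedAd G hG g X‖ = ‖X‖ :=
  (closedAd G hG g).norm_map X

/-- **HYPOTHESIS `hn` DISCHARGED for the operator norm (19)**: `opNormG (Ad(g)X) = opNormG X`.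
[cite: Balaban1985Averaging, (19) p.21] -/
theorem opNormG_closedAd (g : G) (X : lieG G hG) : opNormG G hG (closedAd G hG g X) = opNormG G hG X := by
  unfold opNormG
  rw [coe_closedAd]
  exact opNorm_conj_unitary (g : Matrix.unitaryGroup n ℂ) X

/-! ## §4 Consequences: the hypothesis-carrying lemmas of `T4AdjointCovariance` for every closed `G ≤ U(N)`,
with the cell's canonical `GaugeGroup.ofUnitaryRep` structure on `↥G` (gen 9 `B16ZLowerCompactGroup` §4) -/

section Consequences

open Literature.MathematicalPhysics.QuantumLattice (unitaryFundamentalRep)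

variable [Nonempty n] {P : Params} {j : ℕ}

/-- The cell's canonical gauge-group structure on the closed subgroup `G ≤ U(N)`: `dist1 = ‖· − 1‖_op`, `reTr = Re Tr/N`
of the inclusion `G ≤ U(N) ⊂ M_N(ℂ)` (`GaugeGroup.ofUnitaryRep`, as in gen 9 `B16ZLowerCompactGroup.zLower_closedSubgroup`).
[cite: Balaban1985Averaging, (19) p.21] -/
@[reducible] def gaugeGroupOf : GaugeGroup G :=
  GaugeGroup.ofUnitaryRep G ((unitaryFundamentalRep n ℂ).comp G.subtype) fun g => (g : Matrix.unitaryGroup n ℂ).2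

attribute [local instance] gaugeGroupOf

/-- THE COVARIANT DERIVATIVE (3.3) along a `G`-valued background IS A COVARIANT FAMILY for the joint rotation, for every
closed `G ≤ U(N)` — `T4AdjointCovariance.opCovariant_covDeriv` with `hmul`, `hinv` discharged.
[cite: Balaban1985BackgroundPropagators, (3.3) p.391] -/
theorem opCovariant_covDeriv_closedSubgroup :
    OpCovariant (jrot (P := P) (j := j) (G := G)) (adAct (closedAd G hG) (ι := Site P j))
      (adAct (closedAd G hG) (ι := PBond P j)) (covDeriv (closedAd G hG)) :=
  opCovariant_covDeriv (closedAd_mul G hG) (closedAd_inv_apply G hG)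

/-- `covDeriv` commutes with the joint rotation, pointwise form, for every closed `G ≤ U(N)`.
[cite: Balaban1985BackgroundPropagators, (3.3) p.391] -/
theorem covDeriv_conjFun_closedSubgroup (g : G) (U : GaugeField P j G) (lam : SiteField P j (lieG G hG)) :
    covDeriv (closedAd G hG) (conjFun g U) (adAct (closedAd G hG) g lam) =
      adAct (closedAd G hG) g (covDeriv (closedAd G hG) U lam) :=
  covDeriv_conjFun (closedAd_mul G hG) (closedAd_inv_apply G hG) g U lam

/-- THE MIXED CUT-OFF (1.19) IS JOINTLY INVARIANT for every closed `G ≤ U(N)` — `T4AdjointCovariance.mixedSmallOn_joint_iff`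
with `hexp` discharged. [cite: Balaban1988Convergent, (1.19) p.250] -/
theorem mixedSmallOn_joint_iff_closedSubgroup (S : Set (PBond P j)) (δ : ℝ) (g : G) (W U : GaugeField P j G)
    (A : VecField P j (lieG G hG)) :
    MixedSmallOn S δ (closedExp G hG) (conjFun g W) (conjFun g U) (adAct (closedAd G hG) g A) ↔
      MixedSmallOn S δ (closedExp G hG) W U A :=
  mixedSmallOn_joint_iff (closedExp_closedAd G hG) S δ g W U A

/-- … with a rotation-FIXED reference field (hypothesis `hW`, NOT discharged: O-α4 (ii)). [cite: Balaban1988Convergent, (1.19) p.250] -/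
theorem mixedSmallOn_joint_iff_of_fixed_closedSubgroup (S : Set (PBond P j)) (δ : ℝ) {g : G} {W : GaugeField P j G}
    (hW : conjFun g W = W) (U : GaugeField P j G) (A : VecField P j (lieG G hG)) :
    MixedSmallOn S δ (closedExp G hG) W (conjFun g U) (adAct (closedAd G hG) g A) ↔
      MixedSmallOn S δ (closedExp G hG) W U A :=
  mixedSmallOn_joint_iff_of_fixed (closedExp_closedAd G hG) S δ hW U A

/-- The (1.19)-type characteristic function is a jointly invariant weight for every closed `G ≤ U(N)` (fixed reference
field). [cite: Balaban1988Convergent, (1.19) p.250] -/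
theorem invariant_charFn_mixedSmallOn_closedSubgroup (S : Set (PBond P j)) (δ : ℝ) {W : GaugeField P j G}
    (hW : ∀ g : G, conjFun g W = W) :
    Invariant (prodAct (jrot (P := P) (j := j) (G := G)) (adAct (closedAd G hG) (ι := PBond P j)))
      (charFn fun p : GaugeField P j G × VecField P j (lieG G hG) => MixedSmallOn S δ (closedExp G hG) W p.1 p.2) :=
  invariant_charFn_mixedSmallOn (closedExp_closedAd G hG) S δ hW

/-- THE SUP CUT-OFF (1.18) with the Hilbert–Schmidt norm is a jointly invariant weight for every closed `G ≤ U(N)` — `hn`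
discharged. [cite: Balaban1988Convergent, (1.18) p.250] -/
theorem invariant_charFn_supSmallOn_closedSubgroup (S : Set (PBond P j)) (δ : ℝ) :
    Invariant (prodAct (jrot (P := P) (j := j) (G := G)) (adAct (closedAd G hG) (ι := PBond P j)))
      (charFn fun p : GaugeField P j G × VecField P j (lieG G hG) => SupSmallOn S (fun X : lieG G hG => ‖X‖) δ p.2) :=
  invariant_charFn_supSmallOn (norm_closedAd G hG) S δ

/-- … and with the operator norm (19). [cite: Balaban1988Convergent, (1.18) p.250] -/
theorem invariant_charFn_supSmallOn_opNorm_closedSubgroup (S : Set (PBond P j)) (δ : ℝ) :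
    Invariant (prodAct (jrot (P := P) (j := j) (G := G)) (adAct (closedAd G hG) (ι := PBond P j)))
      (charFn fun p : GaugeField P j G × VecField P j (lieG G hG) => SupSmallOn S (opNormG G hG) δ p.2) :=
  invariant_charFn_supSmallOn (opNormG_closedAd G hG) S δ

omit [Nonempty n] in
/-- The sup cut-off alone is invariant under the constant adjoint action (either norm), every closed `G ≤ U(N)`.
[cite: Balaban1988Convergent, (1.18) p.250] -/
theorem supSmallOn_adAct_iff_closedSubgroup {ι : Type*} (S : Set ι) (δ : ℝ) (g : G) (A : ι → lieG G hG) :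
    (SupSmallOn S (fun X : lieG G hG => ‖X‖) δ (adAct (closedAd G hG) g A) ↔
        SupSmallOn S (fun X : lieG G hG => ‖X‖) δ A) ∧
      (SupSmallOn S (opNormG G hG) δ (adAct (closedAd G hG) g A) ↔ SupSmallOn S (opNormG G hG) δ A) :=
  ⟨supSmallOn_adAct_iff (norm_closedAd G hG) δ g A, supSmallOn_adAct_iff (opNormG_closedAd G hG) δ g A⟩

end Consequences

/-! ### §4b Measure level -/

section MeasureLevel

variable [Nonempty n] {P : Params} {j : ℕ} {ι : Type*} [Fintype ι]

attribute [local instance] gaugeGroupOf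

omit [Nonempty n] in
/-- The product Lebesgue measure on 𝐠-valued fields is invariant under the constant adjoint action of every closed
`G ≤ U(N)` (`T4AdjointCovariance.pi_volume_map_adAct`). [cite: Balaban1988Convergent, (1.17) p.250] -/
theorem pi_volume_map_closedAd (g : G) :
    (Measure.pi fun _ : ι => (volume : Measure (lieG G hG))).map (adAct (closedAd G hG) g)
      = Measure.pi fun _ : ι => (volume : Measure (lieG G hG)) :=
  pi_volume_map_adAct (closedAd G hG) g

/-- HAND-OFF for every closed `G ≤ U(N)`: a jointly invariant weight integrates over the 𝐠-valued fluctuation field to a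
`ConjInvariant` function of the `G`-valued background (`T4AdjointCovariance.conjInvariant_marginal`).
[cite: Balaban1988Convergent, (1.17) p.250] -/
theorem conjInvariant_marginal_closedSubgroup {W : Type*} [NormedAddCommGroup W] [NormedSpace ℝ W]
    {w : GaugeField P j G × (ι → lieG G hG) → W}
    (hw : Invariant (prodAct (jrot (P := P) (j := j) (G := G)) (adAct (closedAd G hG) (ι := ι))) w) :
    ConjInvariant fun U : GaugeField P j G => ∫ A, w (U, A) ∂(Measure.pi fun _ : ι => (volume : Measure (lieG G hG))) :=
  conjInvariant_marginal (closedAd G hG) hw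

end MeasureLevel

end Frobenius

/-! ## §5 Non-vacuity: the full group `G = U(N)` recovers `𝔲(N)` -/

section Top

/-- For `G = ⊤ = U(N)` (closed), the Lie algebra 𝐠 is all of 𝔲(N): `lieG ⊤ = lieU n`.
[cite: Balaban1985Averaging, §A p.20] -/
theorem lieG_top_eq_lieU :
    lieG (⊤ : Subgroup (Matrix.unitaryGroup n ℂ)) isClosed_univ = lieU n := by
  apply le_antisymm (lieG_le_lieU ⊤ isClosed_univ)
  intro X hX
  rw [mem_lieG_iff]
  intro t
  have ht : t • X ∈ lieU n := (lieU n).smul_mem t hX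
  exact ⟨⟨NormedSpace.exp (t • X), exp_mem_unitaryGroup_of_mem_lieU ht⟩, trivial, rfl⟩

end Top

end Literature.MathematicalPhysics.QuantumFieldTheory.Balaban1983to89.T4AdjointCovarianceClosedSubgroup

end
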